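import Literature.MathematicalPhysics.QuantumFieldTheory.Balaban1983to89.Node00.LargeFieldReprOfRecord
import Literature.MathematicalPhysics.QuantumFieldTheory.Balaban1983to89.B14Eq218SeqSucc
import Literature.MathematicalPhysics.QuantumFieldTheory.Balaban1983to89.T4AveragingDisintegration

/-!
# NODE 00 — DEFINER ₇b/₉ (T-side), FILE 1: THE T-STEP OF RECORD on (2.18)-representations — the level-(k+1) slot
# `(𝐓e^A)_{k+1}(s')` from the level-k slot by the δ-function integral (3.1) [III] read as the one-step DISINTEGRATION KERNEL,
# its `IsRT` face PROVED from the displayed unity law of the step weights, and the represented tower's slot RECURSION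

Seat `pub-ymgap-node00-def-T` (DEFINER ₇b/₉ «T-STEP + REPRESENTED TOWER», director R48, chair R437).  [III] =
[Balaban1988Convergent], [IV] = [Balaban1989LargeFieldI], [I] = [Balaban1987RG1].  Reading note of record:
`HOME/pub-ymgap-node00-def-T/READING-NOTE-T9.md`.

WHAT THIS FILE IS.  [III] §3 computes one renormalization step `(Tρ_k)(V_{k+1}) = ∫dV_k δ(V̄_kV_{k+1}⁻¹) ρ_k(V_k)` ((3.1) p. 264)
of a density in the (2.18) form `ρ_k = Σ_s χ_k(s)·(𝐓_k e^{A_k})(s)` (def-R's FILE 4 `Node00.LargeFieldReprOfRecord`: index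
`SeqOfRecord`, pinned front factors `chiSeqOfRecord`, residual slot `TexpAOfRecord`) by INSERTING DECOMPOSITIONS OF UNITY — (3.2)
p. 265 (new small-field cubes of `V_{k+1}` → `Ω_{k+1}`), (3.3) p. 265 (the `χ′_k` restrictions on `V_k`), (3.5) p. 265 and (3.16),
(3.20) pp. 268–269 (fluctuation-field decompositions → `Λ_{k+1}`, `S_{k+1}`) —, observing that on `Ω^∼_{k+1}` the OLD constraints
are then redundant (`χ_k(□) = 1`, `χ_{Ax} = 1` there: (3.6)–(3.9) pp. 265–266) and REWRITING every term, at fixed `V_{k+1}`, by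
identities of the `V_k`-integral ((3.10)–(3.25)) into the level-(k+1) form `Σ_{s'} χ_{k+1}(s')·(𝐓_{k+1}e^{A_{k+1}})(s')` ((3.25) p. 270, `𝐓_{k+1} = 𝐓^{(k+1)}𝐓_k` (3.24)).  This file
types the step AT THE VALUE LEVEL, before any rewriting: for a new sequence `s'` (n22-b's `Seq.init s'` = the sequence one step
down) the level-(k+1) SLOT VALUE is DEFINED as
  `(𝐓e^A)_{k+1}(s')(V') := ∫dU δ(ŪV'⁻¹) [ w(s')(U,V') · χ_k(init s')(U) · (𝐓e^A)_k(init s')(U) ]`            (†)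
where `δ(ŪV'⁻¹)dU` is the tree's ONE-STEP DISINTEGRATION KERNEL TRANSPORT `T4AveragingDisintegration.transportK` along Bałaban's
block average of record `avOfRecord` (marginal density × the conditional law of `U` given `Ū = V'`: ONE linear, monotone operator
for all densities, `isRT_kernelTransport` PROVED in tree; NOT the Radon–Nikodym transport `AveragingRT.rnTransport`, whose
versions are not additive over the (2.18) pieces pointwise — chair R437 (d)), and `w` = the STEP WEIGHTS (the resummed (3.2)·(3.3)·
(3.5)·(3.16)·(3.20) factors attached to the new pair `(Ω_{k+1},Λ_{k+1})`) — a RESIDUAL datum `StepWeightsOfRecord` whose law is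
DISPLAYED: `IsStepUnity` = the decomposition of unity ON THE GRAPH `V' = Ū`, weighted by the old constraint `χ_k(s)` (the weakest
form the `IsRT` face needs; print's decompositions resolve unity pointwise).  The new front factor `χ_{k+1}(Ω_{k+1})(V_{k+1})` (def-R's pin) multiplies
(†) from outside; `χ′_k` of (3.3) depends on `V_k` and stays inside (p. 268), i.e. inside `w`.  Everything (3.10)–(3.25) does
to a term — background field, gauge changes of variables, conditional Gaussian integration, def-B's actions — is then a LAW
about the value (†) (Theorem 2 [III] / the `Laws` of `B14NodeKnitRepTower`), not part of the definition, and is NOT asserted.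

CONTENTS.  §1 (generic over r11's sequences `Seq D k`, any measurable averaging, any standard Borel gauge group): the integrand
and the slot `texpASucc` of (†), the unity law `IsStepUnity`, the disintegration bookkeeping of one piece, and THE THEOREM
`isRT_sum_texpASucc`: under `IsStepUnity` (+ integrable pieces, bounded jointly measurable weights, bounded measurable new front
factors) the assembled level-(k+1) density `Σ_{s'} χ_{k+1}(s')·texpASucc(s')` IS an `IsRT`-image of `Σ_s χ_k(s)·T(s)` — the
`isRT_T` face of the represented tower, PROVED (`integral_graph_eq` + n22-b's `Seq.sum_seq_succ_fiber`); `integrable_piece_texpASucc`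
(the new pieces are integrable, so the step iterates).  §2 (of record, `G = SU(N)`, `avg = avOfRecord`): `transportOfRecord`
(def-B's transport parameter `T'`), `tstepOfRecord` (def-R's slot face `TexpASlot … k → TexpASlot … (k+1)`), `isRT_tstepOfRecord`,
`χ_0 ≡ 1` (`chiSeqOfRecord_zero`), and the slot RECURSION of the represented tower `texpAOfRecord E w R` — level 0 = the
one-term representation of `ρ₀` (`rhoZeroOfRecord`, Thm 1 [III] p. 262), level k+1 = `R`-step ∘ T-step, with the R-step a slot
operation PARAMETER (of record: def-R's `rstepSlotOfRecord`, [IV] (0.3)) — and `eval_zero` (`densityOfRepr_texpAOfRecord_zero`).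

HONEST SCOPE.  Definitions of record + kernel bookkeeping; the one analytic face (`IsRT` of the step) is PROVED from DISPLAYED
hypotheses (unity law, measurability, integrability, `k < K`).  VERSION CAVEAT: print's `∫dU δ(ŪV⁻¹)` is the fibre integral
for the induced measure, Mathlib's conditional kernel is a version of it (`dV`-a.e.); pointwise laws asked downstream of
`eval rep_k` are laws about this version and are displayed hypotheses there.  Nothing of Bałaban's estimates asserted; Theorem
2 / (3.10)–(3.25) NOT asserted; no positivity of weights assumed; counts unmoved by this file; nothing
continuum ∕ ℝ⁴ ∕ OS ∕ mass-gap ∕ Clay.  No `sorry`, no `axiom`, no `opaque`, no `instance`, no `notation`.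
-/

noncomputable section

open MeasureTheory
open scoped BigOperators

namespace Literature.MathematicalPhysics.QuantumFieldTheory.Balaban1983to89.Node00

open T4Continuum B14.Eq218Concrete T4AveragingDisintegration T4FiniteEpsInhabited
open B15Eq112TorusCover B14.Eq213MaximalDomains B14DomainGeom

/-! ## §1 GENERIC: the value-level T-step on a (2.18)-slice and its `IsRT` face -/

section Generic

variable {P : Params} {G : Type*} [GaugeGroup G] [MeasurableSpace G] [HaarData G] [StandardBorelSpace G]
variable {α : Type*} {D : ℕ → Set (Set α)} {k : ℕ}

omit [MeasurableSpace G] [HaarData G] [StandardBorelSpace G] in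
/-- The INTEGRAND of (†) for the new sequence `s'` at the coarse field `V'`: step weight × old front factor × old slot, all at
`init s'`. [cite: Balaban1988Convergent, (3.1) p.264, (3.2)–(3.3) p.265 (bookkeeping)] -/
def tstepIntegrand (χk T : Seq D k → Density P k G)
    (w : Seq D (k + 1) → GaugeField P k G → GaugeField P (k + 1) G → ℝ) (s' : Seq D (k + 1))
    (V' : GaugeField P (k + 1) G) : Density P k G :=
  fun U => w s' U V' * (χk s'.init U * T s'.init U)

/-- **THE VALUE-LEVEL T-STEP (†)**: `(𝐓e^A)_{k+1}(s')(V') := ∫dU δ(ŪV'⁻¹)[w(s')(U,V') χ_k(init s')(U) (𝐓e^A)_k(init s')(U)]`, the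
δ-function integral (3.1) read as the one-step disintegration kernel transport `transportK` along `avg`.
[cite: Balaban1988Convergent, (3.1) p.264, (3.24)–(3.25) p.270] -/
def texpASucc (avg : GaugeField P k G → GaugeField P (k + 1) G) (χk T : Seq D k → Density P k G)
    (w : Seq D (k + 1) → GaugeField P k G → GaugeField P (k + 1) G → ℝ) (s' : Seq D (k + 1)) :
    Density P (k + 1) G :=
  fun V' => transportK avg (tstepIntegrand χk T w s' V') V'

/-- Unfolding of (†): marginal density × the integral against the conditional law of the fine field.
[cite: Balaban1988Convergent, (3.1) p.264 (bookkeeping)] -/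
theorem texpASucc_apply (avg : GaugeField P k G → GaugeField P (k + 1) G) (χk T : Seq D k → Density P k G)
    (w : Seq D (k + 1) → GaugeField P k G → GaugeField P (k + 1) G → ℝ) (s' : Seq D (k + 1))
    (V' : GaugeField P (k + 1) G) :
    texpASucc avg χk T w s' V' =
      (avgDensity avg V' : ℝ) * ∫ U, w s' U V' * (χk s'.init U * T s'.init U) ∂(avgKernel avg V') := rfl

omit [MeasurableSpace G] [HaarData G] [StandardBorelSpace G] in
open Classical in
/-- **THE UNITY LAW OF THE STEP WEIGHTS** (displayed; the resummed decompositions of unity (3.2)·(3.3)·(3.5)·(3.16)·(3.20)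
against the new front factors `χ_{k+1}`), ON THE GRAPH `V' = Ū` and WEIGHTED by the old constraint `χ_k(s)(U)` — the weakest
form the `IsRT` face needs (print's decompositions resolve unity pointwise in `(U, V')`; on `Ω^∼_{k+1}` they make the old constraints
redundant, (3.6)–(3.9)): `χ_k(s)(U) · Σ_{s' : init s' = s} χ_{k+1}(s')(Ū)·w(s')(U,Ū) = χ_k(s)(U)`.
[cite: Balaban1988Convergent, (3.2)–(3.3) p.265, (3.6)–(3.9) pp.265–266, (3.16) p.268] -/
def IsStepUnity [Finite α] (avg : GaugeField P k G → GaugeField P (k + 1) G) (χk : Seq D k → Density P k G)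
    (χk1 : Seq D (k + 1) → Density P (k + 1) G)
    (w : Seq D (k + 1) → GaugeField P k G → GaugeField P (k + 1) G → ℝ) : Prop :=
  ∀ (s : Seq D k) (U : GaugeField P k G),
    χk s U * ∑ s' ∈ Finset.univ.filter (fun s' : Seq D (k + 1) => s'.init = s), χk1 s' (avg U) * w s' U (avg U)
      = χk s U

/-! ### The `IsRT` face of the step, PROVED from the unity law -/

section StepRT

variable {avg : GaugeField P k G → GaugeField P (k + 1) G}

omit [StandardBorelSpace G] in
/-- Graph-side integrability of one piece: an integrable `F` times a bounded jointly measurable cofactor `b(Ū, U)`.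
[cite: Balaban1988Convergent, (3.1) p.264 (bookkeeping)] -/
theorem integrable_graph_piece (havg : Measurable avg) {F : Density P k G} (hF : Integrable F (fieldMeasure P k G))
    {b : GaugeField P (k + 1) G × GaugeField P k G → ℝ} (hb : Measurable b) {C : ℝ} (hbC : ∀ z, ‖b z‖ ≤ C) :
    Integrable (fun U => F U * b (avg U, U)) (fieldMeasure P k G) :=
  hF.mul_bdd (hb.comp (measurable_graphMap havg)).aestronglyMeasurable (Filter.Eventually.of_forall fun _ => hbC _)

/-- Coarse-side integrability of the transported piece `V ↦ h(V) ∫ F(U) b(V,U) κ_V(dU)`.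
[cite: Balaban1988Convergent, (3.1) p.264 (bookkeeping)] -/
theorem integrable_transport_piece (havg : Measurable avg) (hac : HaarAC avg) {F : Density P k G}
    (hF : Integrable F (fieldMeasure P k G)) {b : GaugeField P (k + 1) G × GaugeField P k G → ℝ} (hb : Measurable b)
    {C : ℝ} (hbC : ∀ z, ‖b z‖ ≤ C) :
    Integrable (fun V => (avgDensity avg V : ℝ) * ∫ U, F U * b (V, U) ∂(avgKernel avg V)) (fieldMeasure P (k + 1) G) := by
  have hgm : AEStronglyMeasurable (fun z : GaugeField P (k + 1) G × GaugeField P k G => F z.2 * b z)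
      (jointLaw (fieldMeasure P k G) avg) :=
    (aestronglyMeasurable_comp_snd_jointLaw _ havg hF.1).mul hb.aestronglyMeasurable
  have hgi : Integrable (fun z : GaugeField P (k + 1) G × GaugeField P k G => F z.2 * b z)
      (jointLaw (fieldMeasure P k G) avg) :=
    (integrable_jointLaw_iff _ havg hgm).2 (integrable_graph_piece havg hF hb hbC)
  have hI := (integrable_margDensity_mul (fieldMeasure P k G) (fieldMeasure P (k + 1) G) havg hac hgi).integral_compProd
  refine hI.congr (ae_of_all _ fun V => ?_)
  exact integral_const_mul ((avgDensity avg V : ℝ)) (fun U => F U * b (V, U))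

/-- The integrated identity of one transported piece: `∫ h(V) [∫ F b(V,·) dκ_V] dV = ∫ F(U) b(Ū,U) dU` (the tree's
`integral_graph_eq`). [cite: Balaban1988Convergent, (3.1) p.264 (bookkeeping)] -/
theorem integral_transport_piece (havg : Measurable avg) (hac : HaarAC avg) {F : Density P k G}
    (hF : Integrable F (fieldMeasure P k G)) {b : GaugeField P (k + 1) G × GaugeField P k G → ℝ} (hb : Measurable b)
    {C : ℝ} (hbC : ∀ z, ‖b z‖ ≤ C) :
    ∫ V, (avgDensity avg V : ℝ) * ∫ U, F U * b (V, U) ∂(avgKernel avg V) ∂(fieldMeasure P (k + 1) G)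
      = ∫ U, F U * b (avg U, U) ∂(fieldMeasure P k G) := by
  have hgm : AEStronglyMeasurable (fun z : GaugeField P (k + 1) G × GaugeField P k G => F z.2 * b z)
      (jointLaw (fieldMeasure P k G) avg) :=
    (aestronglyMeasurable_comp_snd_jointLaw _ havg hF.1).mul hb.aestronglyMeasurable
  exact (integral_graph_eq (fieldMeasure P k G) (fieldMeasure P (k + 1) G) havg hac hgm
    (integrable_graph_piece havg hF hb hbC)).symm

/-- **THE STEP IS A RENORMALIZATION TRANSFORMATION** (value level): under the unity law `IsStepUnity`, the assembled density
`Σ_{s'} χ_{k+1}(s')·texpASucc(s')` is an `IsRT`-image along `avg` of `Σ_s χ_k(s)·T(s)` — for a measurable averaging with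
`HaarAC`, integrable pieces, bounded jointly measurable weights and bounded measurable new front factors.  (The `isRT_T` face
of the represented tower; the k = 0 precedent is `B14Eq111Resummation.isRT_eq111`.)
[cite: Balaban1988Convergent, (3.1) p.264, (3.25) p.270] -/
theorem isRT_sum_texpASucc [Finite α] (havg : Measurable avg) (hac : HaarAC avg) (χk T : Seq D k → Density P k G)
    (χk1 : Seq D (k + 1) → Density P (k + 1) G) (w : Seq D (k + 1) → GaugeField P k G → GaugeField P (k + 1) G → ℝ)
    (hT : ∀ s, Integrable (fun U => χk s U * T s U) (fieldMeasure P k G))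
    (hw : ∀ s', Measurable (fun z : GaugeField P (k + 1) G × GaugeField P k G => w s' z.2 z.1))
    (hwb : ∀ s' U V', |w s' U V'| ≤ 1) (hχ : ∀ s', Measurable (χk1 s')) (hχb : ∀ s' V', |χk1 s' V'| ≤ 1)
    (hunit : IsStepUnity avg χk χk1 w) :
    IsRT avg (fun U => ∑ s, χk s U * T s U) (fun V' => ∑ s', χk1 s' V' * texpASucc avg χk T w s' V') := by
  classical
  intro f hf hfC
  obtain ⟨C, hC⟩ := hfC
  have hb : ∀ s', Measurable
      (fun z : GaugeField P (k + 1) G × GaugeField P k G => w s' z.2 z.1 * (χk1 s' z.1 * f z.1)) :=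
    fun s' => (hw s').mul (((hχ s').comp measurable_fst).mul (hf.comp measurable_fst))
  have hbC : ∀ s' (z : GaugeField P (k + 1) G × GaugeField P k G), ‖w s' z.2 z.1 * (χk1 s' z.1 * f z.1)‖ ≤ C := by
    intro s' z
    rw [Real.norm_eq_abs, abs_mul, abs_mul]
    calc |w s' z.2 z.1| * (|χk1 s' z.1| * |f z.1|) ≤ 1 * (1 * C) :=
          mul_le_mul (hwb _ _ _) (mul_le_mul (hχb _ _) (hC _) (abs_nonneg _) zero_le_one)
            (mul_nonneg (abs_nonneg _) (abs_nonneg _)) zero_le_one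
      _ = C := by ring
  have e : ∀ s' V, χk1 s' V * texpASucc avg χk T w s' V * f V =
      (avgDensity avg V : ℝ) * ∫ U, (χk s'.init U * T s'.init U) * (w s' U V * (χk1 s' V * f V)) ∂(avgKernel avg V) := by
    intro s' V
    have : ∫ U, (χk s'.init U * T s'.init U) * (w s' U V * (χk1 s' V * f V)) ∂(avgKernel avg V)
        = (∫ U, w s' U V * (χk s'.init U * T s'.init U) ∂(avgKernel avg V)) * (χk1 s' V * f V) := by
      rw [← integral_mul_const]
      refine integral_congr_ae (ae_of_all _ fun U => ?_)
      ring
    rw [this, texpASucc_apply]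
    ring
  have step1 : ∀ V, (∑ s', χk1 s' V * texpASucc avg χk T w s' V) * f V =
      ∑ s', (avgDensity avg V : ℝ) *
        ∫ U, (χk s'.init U * T s'.init U) * (w s' U V * (χk1 s' V * f V)) ∂(avgKernel avg V) := by
    intro V
    rw [Finset.sum_mul]
    exact Finset.sum_congr rfl fun s' _ => e s' V
  have step2 : ∀ U, ∑ s', (χk s'.init U * T s'.init U) * (w s' U (avg U) * (χk1 s' (avg U) * f (avg U))) =
      (∑ s, χk s U * T s U) * f (avg U) := by
    intro U
    rw [Seq.sum_seq_succ_fiber, Finset.sum_mul]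
    refine Finset.sum_congr rfl fun s _ => ?_
    have hu := hunit s U
    calc ∑ s' ∈ Finset.univ.filter (fun s' : Seq D (k + 1) => s'.init = s),
          (χk s'.init U * T s'.init U) * (w s' U (avg U) * (χk1 s' (avg U) * f (avg U)))
        = ∑ s' ∈ Finset.univ.filter (fun s' : Seq D (k + 1) => s'.init = s),
            (T s U * f (avg U)) * (χk s U * (χk1 s' (avg U) * w s' U (avg U))) := by
          refine Finset.sum_congr rfl fun s' hs' => ?_
          rw [(Finset.mem_filter.1 hs').2]
          ring
      _ = (χk s U * T s U) * f (avg U) := by rw [← Finset.mul_sum, ← Finset.mul_sum, hu]; ring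
  calc ∫ V, (∑ s', χk1 s' V * texpASucc avg χk T w s' V) * f V ∂(fieldMeasure P (k + 1) G)
      = ∫ V, ∑ s', (avgDensity avg V : ℝ) *
          ∫ U, (χk s'.init U * T s'.init U) * (w s' U V * (χk1 s' V * f V)) ∂(avgKernel avg V)
            ∂(fieldMeasure P (k + 1) G) := integral_congr_ae (ae_of_all _ step1)
    _ = ∑ s', ∫ V, (avgDensity avg V : ℝ) *
          ∫ U, (χk s'.init U * T s'.init U) * (w s' U V * (χk1 s' V * f V)) ∂(avgKernel avg V)
            ∂(fieldMeasure P (k + 1) G) :=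
        integral_finsetSum _ fun s' _ => integrable_transport_piece havg hac (hT s'.init) (hb s') (hbC s')
    _ = ∑ s', ∫ U, (χk s'.init U * T s'.init U) * (w s' U (avg U) * (χk1 s' (avg U) * f (avg U)))
          ∂(fieldMeasure P k G) :=
        Finset.sum_congr rfl fun s' _ => integral_transport_piece havg hac (hT s'.init) (hb s') (hbC s')
    _ = ∫ U, ∑ s', (χk s'.init U * T s'.init U) * (w s' U (avg U) * (χk1 s' (avg U) * f (avg U)))
          ∂(fieldMeasure P k G) :=
        (integral_finsetSum _ fun s' _ => integrable_graph_piece havg (hT s'.init) (hb s') (hbC s')).symm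
    _ = ∫ U, (∑ s, χk s U * T s U) * f (avg U) ∂(fieldMeasure P k G) := integral_congr_ae (ae_of_all _ step2)

/-- The new pieces `χ_{k+1}(s')·texpASucc(s')` are INTEGRABLE (so the step can be iterated): integrable old piece, bounded
jointly measurable weight, bounded measurable new front factor. [cite: Balaban1988Convergent, (3.25) p.270 (bookkeeping)] -/
theorem integrable_piece_texpASucc (havg : Measurable avg) (hac : HaarAC avg) (χk T : Seq D k → Density P k G)
    (χk1 : Seq D (k + 1) → Density P (k + 1) G) (w : Seq D (k + 1) → GaugeField P k G → GaugeField P (k + 1) G → ℝ)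
    (s' : Seq D (k + 1)) (hT : Integrable (fun U => χk s'.init U * T s'.init U) (fieldMeasure P k G))
    (hw : Measurable (fun z : GaugeField P (k + 1) G × GaugeField P k G => w s' z.2 z.1))
    (hwb : ∀ U V', |w s' U V'| ≤ 1) (hχ : Measurable (χk1 s')) (hχb : ∀ V', |χk1 s' V'| ≤ 1) :
    Integrable (fun V' => χk1 s' V' * texpASucc avg χk T w s' V') (fieldMeasure P (k + 1) G) := by
  have hb : Measurable (fun z : GaugeField P (k + 1) G × GaugeField P k G => w s' z.2 z.1 * χk1 s' z.1) :=
    hw.mul (hχ.comp measurable_fst)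
  have hbC : ∀ z : GaugeField P (k + 1) G × GaugeField P k G, ‖w s' z.2 z.1 * χk1 s' z.1‖ ≤ 1 := by
    intro z
    rw [Real.norm_eq_abs, abs_mul]
    calc |w s' z.2 z.1| * |χk1 s' z.1| ≤ 1 * 1 := mul_le_mul (hwb _ _) (hχb _) (abs_nonneg _) zero_le_one
      _ = 1 := by ring
  refine (integrable_transport_piece havg hac hT hb hbC).congr (ae_of_all _ fun V => ?_)
  have : ∫ U, (χk s'.init U * T s'.init U) * (w s' U V * χk1 s' V) ∂(avgKernel avg V)
      = (∫ U, w s' U V * (χk s'.init U * T s'.init U) ∂(avgKernel avg V)) * χk1 s' V := by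
    rw [← integral_mul_const]
    refine integral_congr_ae (ae_of_all _ fun U => ?_)
    ring
  show (avgDensity avg V : ℝ) * ∫ U, (χk s'.init U * T s'.init U) * (w s' U V * χk1 s' V) ∂(avgKernel avg V)
    = χk1 s' V * texpASucc avg χk T w s' V
  rw [this, texpASucc_apply]
  ring

end StepRT

end Generic

/-! ## §2 OF RECORD: `G = SU(N)`, the averaging of record, def-R's index and front factors -/

variable (F : T4Family) (N : ℕ) [NeZero N]

/-- **THE ONE-STEP TRANSPORT OF RECORD** on densities (def-B's transport parameter `T'`): the disintegration-kernel transport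
along Bałaban's block averaging of record `avOfRecord F N K k`. [cite: Balaban1988Convergent, (3.1) p.264; Balaban1987RG1, (0.4) p.253] -/
def transportOfRecord (K k : ℕ) : Density (F.P K) k (SU N) → Density (F.P K) (k + 1) (SU N) :=
  transportK (avOfRecord F N K k).avg

/-- The transport of record IS a renormalization transformation (`Setup.IsRT`) of every integrable density, at every step
`k < K` (tree: `isRT_kernelTransport`, `avOfRecord_measurable`, `avOfRecord_haarAC`).
[cite: Balaban1988Convergent, (3.1) p.264; Balaban1987RG1, (0.4) p.253 (kernel property of the tree's transport, by name)] -/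
theorem isRT_transportOfRecord (K k : ℕ) (hk : k < K) (ρ : Density (F.P K) k (SU N))
    (hρ : Integrable ρ (fieldMeasure (F.P K) k (SU N))) :
    IsRT (avOfRecord F N K k).avg ρ (transportOfRecord F N K k ρ) :=
  isRT_kernelTransport (avOfRecord_measurable F N K k) (avOfRecord_haarAC F N K k hk) ρ hρ

/-- The transport of record preserves positivity pointwise. [cite: Balaban1988Convergent, (3.1) p.264 (bookkeeping)] -/
theorem transportOfRecord_nonneg (K k : ℕ) (ρ : Density (F.P K) k (SU N)) (h0 : ∀ U, 0 ≤ ρ U)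
    (V : GaugeField (F.P K) (k + 1) (SU N)) : 0 ≤ transportOfRecord F N K k ρ V :=
  kernelTransport_nonneg h0 V

/-- **THE STEP-WEIGHT DATA TYPE OF RECORD** (residual): per run, coupling sequence and step, a weight `w(s')(U, V')` for every
new sequence `s'` — the resummed decomposition-of-unity factors of [III] §3 attached to the new pair `(Ω_{k+1}, Λ_{k+1}) = s'.extOf`;
its law is `IsStepUnity`. [cite: Balaban1988Convergent, (3.2)–(3.5) p.265, (3.16) p.268, (3.20) p.269] -/
abbrev StepWeightsOfRecord (ν : Stage7Numerics) (M : ℕ) : Type :=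
  (p : B12.RunParams) → (g : ℕ → ℝ) → (k : ℕ) → SeqOfRecord F ν M g p.K (k + 1) →
    GaugeField (F.P p.K) k (SU N) → GaugeField (F.P p.K) (k + 1) (SU N) → ℝ

/-- **THE T-STEP OF RECORD** on a level-k slot (def-R's slot face `TexpASlot … k → TexpASlot … (k+1)`): (†) along `avOfRecord`
with def-R's pinned front factors `chiSeqOfRecord` and the step weights `w`. [cite: Balaban1988Convergent, (3.1) p.264, (3.24)–(3.25) p.270] -/
def tstepOfRecord (ν : Stage7Numerics) (M : ℕ) (w : StepWeightsOfRecord F N ν M) (p : B12.RunParams) (g : ℕ → ℝ)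
    (k : ℕ) (T : SeqOfRecord F ν M g p.K k → Density (F.P p.K) k (SU N)) :
    SeqOfRecord F ν M g p.K (k + 1) → Density (F.P p.K) (k + 1) (SU N) :=
  texpASucc (avOfRecord F N p.K k).avg (chiSeqOfRecord F N ν M g p.K k) T (w p g k)

/-- Unfolding of the T-step of record through `transportOfRecord`. [cite: Balaban1988Convergent, (3.1) p.264 (bookkeeping)] -/
theorem tstepOfRecord_apply (ν : Stage7Numerics) (M : ℕ) (w : StepWeightsOfRecord F N ν M) (p : B12.RunParams)
    (g : ℕ → ℝ) (k : ℕ) (T : SeqOfRecord F ν M g p.K k → Density (F.P p.K) k (SU N))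
    (s' : SeqOfRecord F ν M g p.K (k + 1)) (V' : GaugeField (F.P p.K) (k + 1) (SU N)) :
    tstepOfRecord F N ν M w p g k T s' V' =
      transportOfRecord F N p.K k
        (fun U => w p g k s' U V' * (chiSeqOfRecord F N ν M g p.K k s'.init U * T s'.init U)) V' := rfl

/-- `|χ_k(s)| ≤ 1` for def-R's pinned front factors (a product of characteristic functions).
[cite: Balaban1988Convergent, (2.17)–(2.18) p.257 (bookkeeping)] -/
theorem abs_chiSeqOfRecord_le_one (ν : Stage7Numerics) (M : ℕ) (g : ℕ → ℝ) (K k : ℕ) (s : SeqOfRecord F ν M g K k)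
    (V : GaugeField (F.P K) k (SU N)) : |chiSeqOfRecord F N ν M g K k s V| ≤ 1 := by
  rw [chiSeqOfRecord]
  refine abs_le.2 ⟨?_, chi218_le_one _ _ _ _ _ _ _ _ _⟩
  exact le_trans (by norm_num) (chi218_nonneg _ _ _ _ _ _ _ _ _)

/-- **THE T-STEP OF RECORD IS AN RT** at the level of assembled densities (the `isRT_T` face of the represented tower): from the
DISPLAYED unity law of the step weights, for `k < K`, integrable level-k pieces, bounded jointly measurable weights and measurable
new front factors. [cite: Balaban1988Convergent, (3.1) p.264, (3.25) p.270] -/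
theorem isRT_tstepOfRecord (ν : Stage7Numerics) (M : ℕ) (w : StepWeightsOfRecord F N ν M) (p : B12.RunParams)
    (g : ℕ → ℝ) (k : ℕ) (hk : k < p.K) (T : SeqOfRecord F ν M g p.K k → Density (F.P p.K) k (SU N))
    (hT : ∀ s, Integrable (fun U => chiSeqOfRecord F N ν M g p.K k s U * T s U) (fieldMeasure (F.P p.K) k (SU N)))
    (hw : ∀ s', Measurable
      (fun z : GaugeField (F.P p.K) (k + 1) (SU N) × GaugeField (F.P p.K) k (SU N) => w p g k s' z.2 z.1))
    (hwb : ∀ s' U V', |w p g k s' U V'| ≤ 1) (hχ : ∀ s', Measurable (chiSeqOfRecord F N ν M g p.K (k + 1) s'))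
    (hunit : IsStepUnity (avOfRecord F N p.K k).avg (chiSeqOfRecord F N ν M g p.K k)
      (chiSeqOfRecord F N ν M g p.K (k + 1)) (w p g k)) :
    IsRT (avOfRecord F N p.K k).avg (fun U => ∑ s, chiSeqOfRecord F N ν M g p.K k s U * T s U)
      (fun V' => ∑ s', chiSeqOfRecord F N ν M g p.K (k + 1) s' V' * tstepOfRecord F N ν M w p g k T s' V') :=
  isRT_sum_texpASucc (avOfRecord_measurable F N p.K k) (avOfRecord_haarAC F N p.K k hk) _ T _ _ hT hw hwb hχ
    (fun s' V' => abs_chiSeqOfRecord_le_one F N ν M g p.K (k + 1) s' V') hunit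

/-- **`χ_0 ≡ 1`**: at step 0 the pinned front factor is the empty product (`Ω_0 = ∅` by `Seq.Ω_off`; no cube of positive side
lies in `∅`, and there are no cubes of side 0). [cite: Balaban1988Convergent, (2.18) p.257, (2.1) p.254 (bookkeeping)] -/
theorem chiSeqOfRecord_zero (ν : Stage7Numerics) (M : ℕ) (g : ℕ → ℝ) (K : ℕ) (s : SeqOfRecord F ν M g K 0)
    (V : GaugeField (F.P K) 0 (SU N)) : chiSeqOfRecord F N ν M g K 0 s V = 1 := by
  rw [chiSeqOfRecord, chi218_apply]
  apply Finset.prod_eq_one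
  rintro ⟨x, hx⟩ hc
  exfalso
  rw [mem_cubesIn, s.Ω_off 0 (by omega), Set.subset_empty_iff] at hc
  rcases Nat.eq_zero_or_pos (cubeSide (F.P K).L ν.M₂ (RkOfRecord (F.P K).L ν.r (g 0)) 0) with h0 | hpos
  · rw [h0] at hx
    haveI : Nonempty (Fin (F.P K).d) := ⟨⟨0, (F.P K).hd⟩⟩
    simp [cubeIndices] at hx
    exact Finset.notMem_empty x hx
  · have hmem : cover (F.P K) (fun i => (cubeSide (F.P K).L ν.M₂ (RkOfRecord (F.P K).L ν.r (g 0)) 0 : ℤ) * x i)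
        ∈ cubeEnl (F.P K) (cubeSide (F.P K).L ν.M₂ (RkOfRecord (F.P K).L ν.r (g 0)) 0) x 0 := by
      refine ⟨_, fun i => ⟨?_, ?_⟩, rfl⟩
      · simp
      · push_cast
        omega
    rw [hc] at hmem
    exact hmem

/-! ### The slot recursion of the represented tower (the R-step a slot-operation PARAMETER) -/

/-- A SLOT OPERATION datum: per run, couplings and level, an operation on level-k slots — the shape of the R-step acting on
the `𝐓e^A` slot (of record: def-R's `rstepSlotOfRecord`, [IV] (0.3)). [cite: Balaban1989LargeFieldI, (0.3) p.176 (bookkeeping)] -/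
abbrev SliceOpOfRecord (ν : Stage7Numerics) (M : ℕ) : Type :=
  (p : B12.RunParams) → (g : ℕ → ℝ) → (k : ℕ) →
    (SeqOfRecord F ν M g p.K k → Density (F.P p.K) k (SU N)) →
      (SeqOfRecord F ν M g p.K k → Density (F.P p.K) k (SU N))

/-- **THE SLOT FAMILY OF THE REPRESENTED TOWER** (post-𝐑), by recursion on the step: level 0 = the ONE-TERM representation of
the starting density `ρ₀ = rhoZeroOfRecord` (Thm 1 [III] p. 262; constant `E p`, coupling `g 0`) — every sequence of length 0 carries
`ρ₀` and `χ_0 ≡ 1` —; level k+1 = the R-step `R` applied to the T-step (†) of level k (`𝐓_{k+1} = 𝐓^{(k+1)}𝐓_k` (3.24), then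
`R` [IV] (0.3)). [cite: Balaban1988Convergent, (2.18) p.257, (3.24) p.270; Balaban1989LargeFieldI, (0.3) p.176] -/
def texpAOfRecord (ν : Stage7Numerics) (M : ℕ) (E : B12.RunParams → ℝ) (w : StepWeightsOfRecord F N ν M)
    (R : SliceOpOfRecord F N ν M) : TexpAOfRecord F N ν M :=
  fun p g k => Nat.rec (motive := fun k => SeqOfRecord F ν M g p.K k → Density (F.P p.K) k (SU N))
    (fun _ => rhoZeroOfRecord F N p.K (g 0) (E p))
    (fun k T => R p g (k + 1) (tstepOfRecord F N ν M w p g k T)) k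

/-- THE PRE-𝐑 SLOT at level k+1: the T-step (†) of the tower's level-k slot (`eval` of it is `𝐓ρ_k` of record).
[cite: Balaban1988Convergent, (3.24)–(3.25) p.270] -/
def texpATOfRecord (ν : Stage7Numerics) (M : ℕ) (E : B12.RunParams → ℝ) (w : StepWeightsOfRecord F N ν M)
    (R : SliceOpOfRecord F N ν M) (p : B12.RunParams) (g : ℕ → ℝ) (k : ℕ) :
    SeqOfRecord F ν M g p.K (k + 1) → Density (F.P p.K) (k + 1) (SU N) :=
  tstepOfRecord F N ν M w p g k (texpAOfRecord F N ν M E w R p g k)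

/-- Level 0 of the slot family is `ρ₀` on every (length-0) sequence. [cite: Balaban1988Convergent, (2.18) p.257 (bookkeeping)] -/
theorem texpAOfRecord_zero (ν : Stage7Numerics) (M : ℕ) (E : B12.RunParams → ℝ) (w : StepWeightsOfRecord F N ν M)
    (R : SliceOpOfRecord F N ν M) (p : B12.RunParams) (g : ℕ → ℝ) (s : SeqOfRecord F ν M g p.K 0) :
    texpAOfRecord F N ν M E w R p g 0 s = rhoZeroOfRecord F N p.K (g 0) (E p) := rfl

/-- Level k+1 of the slot family is the R-step of the pre-𝐑 slot. [cite: Balaban1989LargeFieldI, (0.3) p.176 (bookkeeping)] -/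
theorem texpAOfRecord_succ (ν : Stage7Numerics) (M : ℕ) (E : B12.RunParams → ℝ) (w : StepWeightsOfRecord F N ν M)
    (R : SliceOpOfRecord F N ν M) (p : B12.RunParams) (g : ℕ → ℝ) (k : ℕ) :
    texpAOfRecord F N ν M E w R p g (k + 1) = R p g (k + 1) (texpATOfRecord F N ν M E w R p g k) := rfl

/-- **`eval_zero`**: the assembled density of the represented tower at step 0 IS `ρ₀` (one term, `χ_0 ≡ 1`; n22-b's
`Seq.sum_seq_zero`). [cite: Balaban1988Convergent, Thm 1 p.262, (2.18) p.257] -/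
theorem densityOfRepr_texpAOfRecord_zero (ν : Stage7Numerics) (M : ℕ) (E : B12.RunParams → ℝ)
    (w : StepWeightsOfRecord F N ν M) (R : SliceOpOfRecord F N ν M) (p : B12.RunParams) (g : ℕ → ℝ) :
    densityOfRepr F N ν M (texpAOfRecord F N ν M E w R) p g 0 = rhoZeroOfRecord F N p.K (g 0) (E p) := by
  funext V
  rw [densityOfRepr]
  simp only [Seq.sum_seq_zero, chiSeqOfRecord_zero, one_mul]
  rfl

end Literature.MathematicalPhysics.QuantumFieldTheory.Balaban1983to89.Node00

end
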